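import Literature.MathematicalPhysics.MHD.HainLustSigmaStability
import HarnessLib

/-!
# MODEL M_kink: the `q₀ = 7/10` member of the exact force-balanced screw-pinch family (internal-kink test
# equilibrium for the F3.σ WITNESS lane) — profile data, force balance, `(1,1)` resonance

LADDER-GRIDFUSION rung F3 (F3.σ lower-bound side; lead g6 RULING 7f (C); lit-4 g6 recipe of record
HOME/lit/4-kink_witness_exact.j278719.json).  A CONSTRUCTION, not a printed equilibrium: the same closed-form
family as `TearingFRS1EqIdealSigmaBoundR5.lean` (`EqSigmaR5.hl5`: `B_z ≡ 1`, `B_θ = r c/(1 + r²)`, pressure FROM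
RADIAL FORCE BALANCE `p = c²/(2(1+r²)²) − c²/8 + c²/400`, `ρ ≡ 1`, `μ₀ = 1`, `γ = 5/3`, wall at `a = 1`,
`c = 1/(R₀q₀)`), but with the safety factor LOWERED to `q(r) = q₀(1 + r²)`, `q₀ = 7/10` (`R₀ = 5a`, so `c = 2/7`):
the `q = 1` surface sits INSIDE the plasma at `r² = 3/7` (the resonance of the `(m, n) = (1, 1)` mode,
`k = −n/R₀ = −1/5`), i.e. the textbook internal-kink configuration.  Print anchor for the family's `q`-SHAPE only:
HamEtAl2013 §4 `q = q₀(1 + λr²/r_a²)` [corpus: paper:arxiv-1308.2070 p0009 L17] has `q₀ = 1.4`; the value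
`q₀ = 0.7` here is a MODEL CHOICE (SYNTHETIC), said so in every sentence.  «MODELLED: straight cylinder, conducting
wall at the plasma, ideal MHD, single helicity; absent: toroidicity (`R₀` only through `k`), resistivity,
vacuum region; MODEL-VALIDITY: MV-7R family + #66 strings; NOT a statement about any device.»

CONTENTS (all [instance data], proved): `uK`, `pK`, `hlK` (the `ScrewPinch.DynProfile`), `contDiff_uK`,
`contDiff_pK`, `pK_pos` (`p > 0` on `[0, 1001/1000]`), `central_beta` (`β₀ = 2p(0) = 151/2450`),
**`isRadialPressureBalanceK`** (the tree predicate `ScrewPinch.Profile.IsRadialPressureBalance` on `(0,1)`: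
EXACT EQUILIBRIUM), `qK_eq` (`q := rB_z/(R₀B_θ) = (7/10)(1 + r²)`), `resonanceK` (`F = kB_z + m u = 0 ⇔ r² = 3/7`
for `(1,1)`), `bsq_posK`, `kineticNorm_nonnegK`.  NO certificate here: this file is the BY-NAME base for the
§10 witness instance (`sigmaModifiedEnergy_star_neg_of_integral_neg`, HainLustSigmaStability v8) and for a §9
upper-bound twin. [instance data]
-/

noncomputable section

open Set
open Literature.MathematicalPhysics.MHD

namespace Summit.Ventures.FusionMHD.Models

namespace KinkEqQ07

/-- `u(r) = c/(1 + r²)`, `c = 1/(R₀q₀) = 2/7` (`R₀ = 5`, `q₀ = 7/10`); `B_θ = r u`. [instance data] -/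
def uK (r : ℝ) : ℝ := 2 / (7 * (1 + r ^ 2))

/-- The FORCE-BALANCE pressure for uniform `B_z = 1`: `p = c²/(2(1+r²)²) − c²/8 + c²/400` with `c² = 4/49`:
`p = 2/(49(1+r²)²) − 1/98 + 1/4900`. [instance data] -/
def pK (r : ℝ) : ℝ := 2 / (49 * (1 + r ^ 2) ^ 2) - 1 / 98 + 1 / 4900

/-- MODEL M_kink: `μ₀ = 1`, `B_θ = r u`, `B_z ≡ 1`, `p = pK`, `ρ ≡ 1`, `γ = 5/3`. [instance data] -/
def hlK : ScrewPinch.DynProfile :=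
  { μ₀ := 1, Bθ := fun r => r * uK r, Bz := fun _ => 1, p := pK, ρ := fun _ => 1, γ := 5 / 3 }

/-- `u ∈ C¹(ℝ)`. [instance data] -/
theorem contDiff_uK : ContDiff ℝ 1 uK := by
  unfold uK
  exact contDiff_const.div (by fun_prop) (fun x => by positivity)

/-- `p ∈ C¹(ℝ)`. [instance data] -/
theorem contDiff_pK : ContDiff ℝ 1 pK := by
  unfold pK
  exact ((contDiff_const.div (by fun_prop) (fun x => by positivity)).sub contDiff_const).add contDiff_const

/-- `p > 0` on `[0, 1001/1000]` (the edge value `c²/400 > 0` keeps the pressure positive slightly beyond the wall).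
[instance data] -/
theorem pK_pos {r : ℝ} (h0 : 0 ≤ r) (h1 : r ≤ 1001 / 1000) : 0 < pK r := by
  have hr2 : r ^ 2 ≤ 1002001 / 1000000 := by nlinarith
  have hD : 0 < (1 + r ^ 2) ^ 2 := by positivity
  have hD2 : (1 + r ^ 2) ^ 2 ≤ (2002001 / 1000000) ^ 2 := by
    apply pow_le_pow_left₀ (by positivity)
    linarith
  unfold pK
  have key : 1 / ((2002001 / 1000000 : ℝ) ^ 2) ≤ 1 / (1 + r ^ 2) ^ 2 :=
    one_div_le_one_div_of_le hD hD2
  have e : (2 : ℝ) / (49 * (1 + r ^ 2) ^ 2) = (2 / 49) * (1 / (1 + r ^ 2) ^ 2) := by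
    field_simp
  rw [e]
  nlinarith [key]

/-- Central beta `β₀ = 2μ₀ p(0)/B_z(0)² = 2 p(0) = 151/2450` (≈ 6.2 %). [instance data] -/
theorem central_beta : 2 * hlK.p 0 = 151 / 2450 := by
  show 2 * pK 0 = 151 / 2450
  unfold pK
  norm_num

/-- `q := r B_z/(R₀ B_θ) = (7/10)(1 + r²)` for `r ≠ 0` (`R₀ = 5`): the model's safety-factor profile, `q₀ = 7/10 < 1`.
[instance data] -/
theorem qK_eq {r : ℝ} (hr : r ≠ 0) : r * hlK.Bz r / (5 * hlK.Bθ r) = 7 / 10 * (1 + r ^ 2) := by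
  have h1 : (1 : ℝ) + r ^ 2 ≠ 0 := by positivity
  show r * 1 / (5 * (r * uK r)) = 7 / 10 * (1 + r ^ 2)
  unfold uK
  field_simp
  ring

/-- **MODEL M_kink IS AN EXACT EQUILIBRIUM**: `d/dr (p + (B_θ² + B_z²)/(2μ₀)) + B_θ²/(μ₀r) = 0` on `(0, 1)`
(the tree predicate). [cite: Schnack2009, Lect. 30 eq. (30.30)] [instance data] -/
theorem isRadialPressureBalanceK : hlK.toProfile.IsRadialPressureBalance 1 := by
  intro r hr
  have hr0 : (0 : ℝ) < r := hr.1
  have key : (fun s => hlK.toProfile.p s + (hlK.toProfile.Bθ s ^ 2 + hlK.toProfile.Bz s ^ 2) / (2 * hlK.toProfile.μ₀))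
      = fun s => 2 / (49 * (1 + s ^ 2)) + ((1 : ℝ) / 2 - 1 / 98 + 1 / 4900) := by
    funext s
    have h1 : (1 : ℝ) + s ^ 2 ≠ 0 := by positivity
    show pK s + ((s * uK s) ^ 2 + 1 ^ 2) / (2 * 1) = _
    simp only [pK, uK]
    field_simp
    ring
  rw [key]
  have h1 : (1 : ℝ) + r ^ 2 ≠ 0 := by positivity
  have hD : HasDerivAt (fun s : ℝ => 49 * (1 + s ^ 2)) (49 * (2 * r)) r := by
    have := ((hasDerivAt_pow 2 r).const_add 1).const_mul (49 : ℝ)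
    simpa using this
  have hinv := ((hD.inv (by positivity)).const_mul (2 : ℝ)).add_const ((1 : ℝ) / 2 - 1 / 98 + 1 / 4900)
  have e : 2 * (-(49 * (2 * r)) / (49 * (1 + r ^ 2)) ^ 2)
      = -(hlK.toProfile.Bθ r ^ 2) / (hlK.toProfile.μ₀ * r) := by
    show _ = -((r * uK r) ^ 2) / (1 * r)
    simp only [uK]
    field_simp
    ring
  rw [← e]
  refine hinv.congr_of_eventuallyEq ?_
  exact Filter.Eventually.of_forall fun s => by
    have hs : (1 : ℝ) + s ^ 2 ≠ 0 := by positivity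
    simp only [Pi.inv_apply]
    field_simp

/-- The resonant surface of the `(1,1)` mode (`k = −1/5`): `F = kB_z + m u = 0` exactly at `r² = 3/7`, i.e. `q = 1`
inside the plasma. [instance data] -/
theorem resonanceK {r : ℝ} : hlK.fReg 1 (-1 / 5) uK r = 0 ↔ r ^ 2 = 3 / 7 := by
  have h1 : (1 : ℝ) + r ^ 2 ≠ 0 := by positivity
  simp only [ScrewPinch.DynProfile.fReg, hlK, uK]
  constructor
  · intro h
    field_simp at h
    linarith
  · intro h
    field_simp
    linarith

/-- `B² = (r u)² + 1 > 0`. [instance data] -/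
theorem bsq_posK (r : ℝ) : 0 < hlK.Bsq r := by
  show 0 < (r * uK r) ^ 2 + (1 : ℝ) ^ 2
  positivity

/-- `I[ξ] ≥ 0` on `[0, 1]` (`ρ ≡ 1`). [instance data] -/
theorem kineticNorm_nonnegK (ξ η ζ : ℝ → ℝ) : 0 ≤ hlK.kineticNorm 1 ξ η ζ := by
  unfold ScrewPinch.DynProfile.kineticNorm
  refine intervalIntegral.integral_nonneg (by norm_num) fun r hr => ?_
  simp only [ScrewPinch.DynProfile.kineticDensity, hlK]
  have : 0 ≤ r := hr.1
  positivity

end KinkEqQ07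

end Summit.Ventures.FusionMHD.Models
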